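import Summits.Parity.BatemanHorn.Theses.AlmostPrimeZeros
import Summits.Parity.BatemanHorn.Theorems.AlmostPrimeZerosDiscMajorantLogLargePrimeSwitch
import Summits.Parity.BatemanHorn.Theorems.AlmostPrimeZerosDiscMajorantLogFinZero
import Summits.Parity.BatemanHorn.Theorems.AlmostPrimeZerosDiscMajorantLogLeftHalfTwinViolation
import Summits.Parity.BatemanHorn.Theorems.AlmostPrimeZerosDiscMajorantLogRightHalfTwinOfDisc
import Summits.Parity.BatemanHorn.Theorems.AlmostPrimeZerosDiscMajorantLogFixedDiscXAdd
import Summits.Parity.BatemanHorn.Theorems.AlmostPrimeZerosDiscMajorantLogGrowingDiscLinear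
import Summits.Parity.BatemanHorn.Theorems.AlmostPrimeZerosDiscMajorantLogRealAxisFixedInterval
import Summits.Parity.BatemanHorn.Theorems.AlmostPrimeZerosDiscMajorantLogNearCentre
import Summits.Parity.BatemanHorn.Theorems.AlmostPrimeZerosDiscMajorantLogPoissonTailOfRealAxisGrowing
import Summits.Parity.BatemanHorn.Theorems.AlmostPrimeZerosDiscMajorantLogPoissonTailLinear

/-!
# Crux `DiscMajorantLog` (stmt-Parity-17114), line `Sketch` — registered skeleton, rev 8
(continuation lead prover-line-stmt-Parity-17114-c2-0, 2026-08-17 13:3xZ; rev 2 registered 06:52Z and rev 3 after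
wave 1 by lead c1; rev 4 = rev 3 re-registered by lead c2 with composition and stub signatures byte-identical —
the three open stubs are named open problems and form the STUCK list; rev 5 (13:55Z) added the support stub
`stub_poissonTailOfRealAxisGrowing` (what R-growing contains: Poisson-sharp tails of `s_f` up to `m ≍ (log log x)²`),
LANDED as `Theorems/AlmostPrimeZerosDiscMajorantLogPoissonTailOfRealAxisGrowing.lean` (p164355) and re-exported
below by name (rev 6, 14:05Z); rev 7 registered `stub_poissonTailLinearClass` (its unconditional instance on the landed
linear class `k = 1, deg = 1`), LANDED as `Theorems/AlmostPrimeZerosDiscMajorantLogPoissonTailLinear.lean` (p164764) and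
re-exported below (rev 8, 14:2xZ);
see `Lines/Sketch-levelx-majorants-real-axis.md` for how far level-`x` majorants can push `stub_realAxisGrowing`
(no obstruction for `Σ deg ≤ 3`, undecided `= 4`, method barrier `≥ 5`))

Route `AlmostPrimeZeros`, crux `Summit.Parity.BatemanHorn.Theses.AlmostPrimeZeros.DiscMajorantLog`:
for every Bateman–Horn system `f = (f_1,…,f_k)` there are `A, C, x₀` with
`‖S_x(z)‖ ≤ A·x·(log x)^{k(Re z − 1)}·exp(C‖z−1‖ log(‖z−1‖+2))` for all `x ≥ x₀` and all `z` in the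
growing disc `‖z − 1‖ ≤ 3 log log x`, where `S_x(z) = Σ_{0 ≤ n ≤ x} z^{s_f(n)}` and
`s_f(n) = Σ_i Σ_{p^v ∥ f_i(n)} min(v,2)`.

## The composition (rev 2/3: the first lead's `Re z = 0` cut, its right half RESHAPED along the k1 atlas)

`DiscMajorantLog_of` ⟸ `rightHalf_of_stubs` ∧ `stub_leftHalfDiscMajorantLog`, and
`rightHalf_of_stubs` (closed right half-disc `0 ≤ Re z`, the registered signature of the first lead's
`stub_rightHalfDiscMajorantLog`, now a THEOREM modulo two stubs) ⟸

* `stub_realAxisFixedInterval` — (R, fixed intervals) the positive real segment `0 < t ≤ T` of the crux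
  for EVERY Bateman–Horn system, every fixed `T`: `Σ_{n≤x} t^{s_f(n)} ≤ A x (log x)^{k(t−1)}`.
  **LANDED** (rev 3): `Theorems/AlmostPrimeZerosDiscMajorantLogRealAxisFixedInterval.lean`, p150589 =
  `stub_realAxisFixedIntervalOfNair` (p149065) ∘ `nairTenenbaumLight` (stmt-Parity-11292, lead c8) —
  Nair–Tenenbaum "light" along the shifted product polynomial with the weights `t^{Σ_p min(v_p,2k)}`
  (`t ≥ 1`) / `t^{ω}` (`t < 1`) and two-sided Mertens along the system; imported and used BY NAME;
* `stub_realAxisGrowing` — (R, growing `t`) the same segment for `T₀ ≤ t ≤ 1 + 3 log log x` with the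
  Γ-budget: the card's K1 "BlindSpotControl" (Poisson-sharp tails of `s_f` up to `m ≍ (log log x)²`):
  OPEN anatomy for every system with `Σ deg ≥ 2` (parity-free, phase-free);
* `stub_rightOffAxis` — (A) the closed right half-disc OFF the positive axis: Halász-type decay of
  `Σ_n z^{s_f(n)}` along `f`; OPEN for every system outside `k ≤ 1, deg ≤ 1` (atlas §2: LPF-law-complete);

and `stub_leftHalfDiscMajorantLog` — (P) the open left half-disc `Re z < 0`: the parity content
(tilted Chowla/Elliott along `f`); OPEN outside `k ≤ 1, deg ≤ 1`.  The cut is lossless (each stub is a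
restriction of the crux) and pointwise in `z`; sorries live only in `stub_*`; `DiscMajorantLog_of`
concludes the crux BY NAME.

## Calibration / support stubs — ALL LANDED in wave 1 of lead c1 (imported above, re-exported below)

* `stub_realAxisFixedIntervalOfNair` p149065 → `stub_realAxisFixedInterval` p150589 (composition stub);
* `stub_growingDiscXWide` p147027, `stub_growingDiscXAddOfWide` p147196 — every MONIC linear system
  `X + c` on the growing disc;
* `stub_apTwistedEulerDataSharp` p147112, `stub_apHolRieszBoundThinWide` p149882,
  `stub_apCharBoundSharpOfParts` p147327, `stub_growingDiscLinearOfCharBound` p147350,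
  `stub_growingDiscLinearOfParts` + `growingDiscLinear` / `discMajorantLog_of_linear` p150865 — the
  Dirichlet-character twin of the sharp engine: the cell `f = aX + b`, `a ≥ 2` (class linₐ) and with the
  monic cell the COMPLETE classical class `k ≤ 1, deg ≤ 1` of the crux on the growing disc;
* `stub_nearCentre` p151291 — the parity-free core for ALL systems: the crux with loss
  `exp(k‖z−1‖² log log x)` on `‖z−1‖ ≤ 1/2`, hence VERBATIM (`C = 0`) on the shrinking disc
  `‖z−1‖² log log x ≤ 1` (`discMajorantLog_shrinkingDisc`).

Landed for the line before (first lead, 12 files): `stub_largePrimeSwitch` p140630, `stub_finZero` p140771,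
`stub_leftHalfTwinViolation` p140801, `stub_rightHalfTwinOfDisc` p140846, `stub_fixedDiscX` p141351,
`stub_fixedDiscXAdd` p144164, E1–E4 p142694 p142232 p142388 p142210 p142266, `stub_growingDiscX` p144724.

OPEN (the only sorries): `stub_realAxisGrowing` (R growing `t`, anatomy), `stub_rightOffAxis` (A, Halász
along `f`), `stub_leftHalfDiscMajorantLog` (P, tilted Chowla along `f`) — each a restriction of the crux,
each known exactly on the class `k ≤ 1, deg ≤ 1` (by the cells above) and a named open problem for every
system with `k ≥ 2` or some `deg f_i ≥ 2`.
-/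

noncomputable section

namespace Summit.Parity.BatemanHorn.Cruxes.DiscMajorantLog.Sketch

open scoped BigOperators
open Polynomial
open Summit.Parity.BatemanHorn.Theses.AlmostPrimeZeros
open Literature.NumberTheory.Sieve

/-! ## The composition stubs (R-fixed is LANDED and imported: `stub_realAxisFixedInterval`, p150589) -/

/-- **Stub R-growing (positive real segment at growing `t`, ALL systems).**  For every Bateman–Horn
system there are `T₀ ≥ 1`, `A, C, x₀` with
`Σ_{0≤n≤x} t^{s_f(n)} ≤ A·x·(log x)^{k(t−1)}·exp(C (t−1) log((t−1)+2))` for all `x ≥ x₀` and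
`T₀ ≤ t ≤ 1 + 3 log log x`.  By Legendre duality this is Hardy–Ramanujan at Poisson precision along
the system for `m ≤ 3k(log log x)² + k log log x` (card `visible-divisor-certificates`, K1): OPEN
anatomy for every system with `Σ deg f_i ≥ 2`; known for `k ≤ 1`, `deg ≤ 1`. -/
theorem stub_realAxisGrowing :
    ∀ (k : ℕ) (f : Fin k → Polynomial ℤ), Literature.NumberTheory.Sieve.IsBatemanHornSystem f →
      ∃ T₀ : ℝ, 1 ≤ T₀ ∧ ∃ A C : ℝ, ∃ x₀ : ℕ, ∀ x : ℕ, x₀ ≤ x → ∀ t : ℝ, T₀ ≤ t →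
        t - 1 ≤ 3 * Real.log (Real.log (x : ℝ)) →
        (∑ n ∈ Finset.range (x + 1), t ^ (∑ i, (((f i).eval (n : ℤ)).toNat.factorization.sum fun _ v => min v 2))) ≤
          A * (x : ℝ) * (Real.log (x : ℝ)) ^ ((k : ℝ) * (t - 1)) *
            Real.exp (C * (t - 1) * Real.log ((t - 1) + 2)) := by
  sorry

/-- **Stub A (closed right half-disc off the positive axis, ALL systems).**  The crux's bound for
`x ≥ x₀`, `‖z − 1‖ ≤ 3 log log x`, `0 ≤ Re z` and `z ∉ (0, ∞)`: Halász-type decay of `Σ_n z^{s_f(n)}`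
along `f` off the axis (pure cancellation between the layers `#{s_f = j}`, `not_abs`).  OPEN for every
system outside `k ≤ 1`, `deg ≤ 1` (atlas §2: LPF-law-complete, not forced by Type-I data + the exact
Hooley 2-fibre); twin-blind, so no parity argument refutes it. -/
theorem stub_rightOffAxis :
    ∀ (k : ℕ) (f : Fin k → Polynomial ℤ), Literature.NumberTheory.Sieve.IsBatemanHornSystem f →
      ∃ A C : ℝ, ∃ x₀ : ℕ, ∀ x : ℕ, x₀ ≤ x → ∀ z : ℂ, ‖z - 1‖ ≤ 3 * Real.log (Real.log (x : ℝ)) →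
        0 ≤ z.re → ¬ (z.im = 0 ∧ 0 < z.re) →
        ‖(∑ n ∈ Finset.range (x + 1), (z : ℂ) ^ (∑ i, (((f i).eval (n : ℤ)).toNat.factorization.sum fun _ v => min v 2)))‖ ≤
          A * (x : ℝ) * (Real.log (x : ℝ)) ^ ((k : ℝ) * ((z : ℂ).re - 1)) *
            Real.exp (C * ‖(z : ℂ) - 1‖ * Real.log (‖(z : ℂ) - 1‖ + 2)) := by
  sorry

/-- **Stub P (open left half-disc `Re z < 0`, ALL systems; registered by the first lead, unchanged).**
The crux's bound for `x ≥ x₀`, `‖z − 1‖ ≤ 3 log log x` and `Re z < 0` — the parity half (tilted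
Chowla/Elliott along `f`; at `z = −1` it is `|Σ_{n≤x} (−1)^{s_f(n)}| ≤ A' x (log x)^{−2k}`).  Known:
`k = 0`; `k = 1`, `f = X + c`.  OPEN (summit-class) for every system with `k ≥ 2` or some `deg f_i ≥ 2`. -/
theorem stub_leftHalfDiscMajorantLog :
    ∀ (k : ℕ) (f : Fin k → Polynomial ℤ), Literature.NumberTheory.Sieve.IsBatemanHornSystem f →
      ∃ A C : ℝ, ∃ x₀ : ℕ, ∀ x : ℕ, x₀ ≤ x → ∀ z : ℂ, ‖z - 1‖ ≤ 3 * Real.log (Real.log (x : ℝ)) →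
        z.re < 0 →
        ‖(∑ n ∈ Finset.range (x + 1), (z : ℂ) ^ (∑ i, (((f i).eval (n : ℤ)).toNat.factorization.sum fun _ v => min v 2)))‖ ≤
          A * (x : ℝ) * (Real.log (x : ℝ)) ^ ((k : ℝ) * ((z : ℂ).re - 1)) *
            Real.exp (C * ‖(z : ℂ) - 1‖ * Real.log (‖(z : ℂ) - 1‖ + 2)) := by
  sorry

/-! ## Support stub of lead c2 (rev 5), LANDED (p164355) and imported: what R-growing CONTAINS -/

/-- **Landed support stub `stub_poissonTailOfRealAxisGrowing` (re-export by name, p164355).**  If the conclusion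
of `stub_realAxisGrowing` holds for a system of `k ≥ 1` polynomials with constants `T₀ ≥ 1, A, C, x₀`, then for
`x ≥ x₀` with `log x > 1` and `T₀·kL ≤ m ≤ (1+3L)·kL` (`L = log log x`):
`#{n ≤ x : m ≤ s_f(n)} ≤ A·x·e^{−kL}·(e k L/m)^m·exp(C (t−1) log((t−1)+2))`, `t = m/(kL)` — Hardy–Ramanujan along
the system at Poisson precision up to `m ≍ (log log x)²` is NECESSARY for R-growing (Markov + Legendre bookkeeping). -/
theorem poissonTailOfRealAxisGrowing :
    ∀ (k : ℕ) (f : Fin k → Polynomial ℤ) (T₀ A C : ℝ) (x₀ : ℕ), 1 ≤ k → 1 ≤ T₀ →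
      (∀ x : ℕ, x₀ ≤ x → ∀ t : ℝ, T₀ ≤ t → t - 1 ≤ 3 * Real.log (Real.log (x : ℝ)) →
        (∑ n ∈ Finset.range (x + 1), t ^ (∑ i, (((f i).eval (n : ℤ)).toNat.factorization.sum fun _ v => min v 2))) ≤
          A * (x : ℝ) * (Real.log (x : ℝ)) ^ ((k : ℝ) * (t - 1)) *
            Real.exp (C * (t - 1) * Real.log ((t - 1) + 2))) →
      ∀ x : ℕ, x₀ ≤ x → 1 < Real.log (x : ℝ) →
      ∀ m : ℕ, T₀ * ((k : ℝ) * Real.log (Real.log (x : ℝ))) ≤ m →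
        (m : ℝ) ≤ (1 + 3 * Real.log (Real.log (x : ℝ))) * ((k : ℝ) * Real.log (Real.log (x : ℝ))) →
        ((((Finset.range (x + 1)).filter (fun n : ℕ =>
            m ≤ ∑ i, (((f i).eval (n : ℤ)).toNat.factorization.sum fun _ v => min v 2))).card : ℕ) : ℝ) ≤
          A * (x : ℝ) * Real.exp (-((k : ℝ) * Real.log (Real.log (x : ℝ)))) *
            (Real.exp 1 * ((k : ℝ) * Real.log (Real.log (x : ℝ))) / m) ^ m *
            Real.exp (C * ((m : ℝ) / ((k : ℝ) * Real.log (Real.log (x : ℝ))) - 1) *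
              Real.log (((m : ℝ) / ((k : ℝ) * Real.log (Real.log (x : ℝ))) - 1) + 2)) :=
  stub_poissonTailOfRealAxisGrowing

/-! ## Support stub of lead c2 (rev 7), LANDED (p164764) and imported: the Poisson tail on the proven linear class -/

/-- **Landed support stub `stub_poissonTailLinearClass` (re-export by name, p164764).**  Unconditionally, for every
Bateman–Horn system with `k = 1`, `deg = 1`: `#{n ≤ x : m ≤ s_f(n)} ≤ A·x·e^{−L}·(e L/m)^m·exp(C (m/L−1) log((m/L−1)+2))`
for `x ≥ x₀`, `log x > 1`, `L ≤ m ≤ (1+3L)·L` — Hardy–Ramanujan at Poisson precision up to `m ≍ (log log x)²` on the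
one proven cell, i.e. exactly what `stub_realAxisGrowing` would give for every system. -/
theorem poissonTailLinearClass :
    ∀ (k : ℕ) (f : Fin k → Polynomial ℤ), Literature.NumberTheory.Sieve.IsBatemanHornSystem f →
      k = 1 → (∀ i, (f i).natDegree = 1) →
      ∃ A C : ℝ, ∃ x₀ : ℕ, ∀ x : ℕ, x₀ ≤ x → 1 < Real.log (x : ℝ) →
        ∀ m : ℕ, (k : ℝ) * Real.log (Real.log (x : ℝ)) ≤ m →
          (m : ℝ) ≤ (1 + 3 * Real.log (Real.log (x : ℝ))) * ((k : ℝ) * Real.log (Real.log (x : ℝ))) →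
          ((((Finset.range (x + 1)).filter (fun n : ℕ =>
              m ≤ ∑ i, (((f i).eval (n : ℤ)).toNat.factorization.sum fun _ v => min v 2))).card : ℕ) : ℝ) ≤
            A * (x : ℝ) * Real.exp (-((k : ℝ) * Real.log (Real.log (x : ℝ)))) *
              (Real.exp 1 * ((k : ℝ) * Real.log (Real.log (x : ℝ))) / m) ^ m *
              Real.exp (C * ((m : ℝ) / ((k : ℝ) * Real.log (Real.log (x : ℝ))) - 1) *
                Real.log (((m : ℝ) / ((k : ℝ) * Real.log (Real.log (x : ℝ))) - 1) + 2)) :=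
  stub_poissonTailLinearClass

/-! ## Composition lemmas -/

/-- Monotonicity of the majorant in its two constants: if `A ≤ A'`, `C ≤ C'` and `A' ≥ 0`, then
`A·P·e^{C r log(r+2)} ≤ A'·P·e^{C' r log(r+2)}` for `P ≥ 0`, `r ≥ 0`. -/
theorem majorant_mono {A A' C C' P r : ℝ} (hA : A ≤ A') (hA' : 0 ≤ A') (hC : C ≤ C') (hP : 0 ≤ P)
    (hr : 0 ≤ r) :
    A * P * Real.exp (C * r * Real.log (r + 2)) ≤ A' * P * Real.exp (C' * r * Real.log (r + 2)) := by
  have hrl : 0 ≤ r * Real.log (r + 2) := mul_nonneg hr (Real.log_nonneg (by linarith))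
  have hexp : Real.exp (C * r * Real.log (r + 2)) ≤ Real.exp (C' * r * Real.log (r + 2)) := by
    apply Real.exp_le_exp.2
    have : C * (r * Real.log (r + 2)) ≤ C' * (r * Real.log (r + 2)) :=
      mul_le_mul_of_nonneg_right hC hrl
    simpa [mul_assoc] using this
  calc A * P * Real.exp (C * r * Real.log (r + 2))
      ≤ A' * P * Real.exp (C * r * Real.log (r + 2)) := by
        gcongr
    _ ≤ A' * P * Real.exp (C' * r * Real.log (r + 2)) :=
        mul_le_mul_of_nonneg_left hexp (mul_nonneg hA' hP)

/-- On the positive real axis the statistic is a sum of nonnegative reals: for `t ≥ 0`,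
`‖Σ_n (t:ℂ)^{e n}‖ = Σ_n t^{e n}`. -/
theorem norm_sum_ofReal_pow (t : ℝ) (ht : 0 ≤ t) (s : Finset ℕ) (e : ℕ → ℕ) :
    ‖∑ n ∈ s, ((t : ℂ)) ^ (e n)‖ = ∑ n ∈ s, t ^ (e n) := by
  have h : (∑ n ∈ s, ((t : ℂ)) ^ (e n)) = ((∑ n ∈ s, t ^ (e n) : ℝ) : ℂ) := by push_cast; rfl
  rw [h, Complex.norm_real, Real.norm_eq_abs,
    abs_of_nonneg (Finset.sum_nonneg fun n _ => pow_nonneg ht _)]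

/-- A complex number with zero imaginary part is the cast of its real part. -/
theorem eq_ofReal_of_im_eq_zero {z : ℂ} (h : z.im = 0) : z = ((z.re : ℝ) : ℂ) :=
  Complex.ext (by simp) (by simp [h])

/-- **The right half-disc from its three parts (R-fixed, R-growing, A).**  This is the first lead's
registered `stub_rightHalfDiscMajorantLog` signature, now a theorem modulo `stub_realAxisFixedInterval`,
`stub_realAxisGrowing`, `stub_rightOffAxis`: on the positive axis `z = t > 0` the sum is
`Σ t^{s_f(n)}` and `‖z − 1‖ = |t − 1|`; use R-fixed for `t ≤ T₀` (the budget factor is `≥ 1` once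
`C ≥ 0`) and R-growing for `t > T₀` (there `|t − 1| = t − 1`); off the axis use A.  Constants `max`-ed. -/
theorem rightHalf_of_stubs :
    ∀ (k : ℕ) (f : Fin k → Polynomial ℤ), Literature.NumberTheory.Sieve.IsBatemanHornSystem f →
      ∃ A C : ℝ, ∃ x₀ : ℕ, ∀ x : ℕ, x₀ ≤ x → ∀ z : ℂ, ‖z - 1‖ ≤ 3 * Real.log (Real.log (x : ℝ)) →
        0 ≤ z.re →
        ‖(∑ n ∈ Finset.range (x + 1), (z : ℂ) ^ (∑ i, (((f i).eval (n : ℤ)).toNat.factorization.sum fun _ v => min v 2)))‖ ≤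
          A * (x : ℝ) * (Real.log (x : ℝ)) ^ ((k : ℝ) * ((z : ℂ).re - 1)) *
            Real.exp (C * ‖(z : ℂ) - 1‖ * Real.log (‖(z : ℂ) - 1‖ + 2)) := by
  intro k f hf
  obtain ⟨T₀, hT₀, A₂, C₂, x₂, hgrow⟩ := stub_realAxisGrowing k f hf
  obtain ⟨A₁, x₁, hfix⟩ := stub_realAxisFixedInterval k f hf T₀ hT₀
  obtain ⟨A₃, C₃, x₃, hoff⟩ := stub_rightOffAxis k f hf
  refine ⟨max (max (max A₁ A₂) A₃) 0, max (max C₂ C₃) 0, max (max (max x₁ x₂) x₃) 2,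
    fun x hx z hz hre => ?_⟩
  have hx₁ : x₁ ≤ x := le_trans (le_trans (le_trans (le_max_left _ _) (le_max_left _ _)) (le_max_left _ _)) hx
  have hx₂ : x₂ ≤ x := le_trans (le_trans (le_trans (le_max_right _ _) (le_max_left _ _)) (le_max_left _ _)) hx
  have hx₃ : x₃ ≤ x := le_trans (le_trans (le_max_right _ _) (le_max_left _ _)) hx
  have hx2 : (2 : ℝ) ≤ x := by exact_mod_cast (le_max_right _ _).trans hx
  have hlogx : 0 < Real.log (x : ℝ) := Real.log_pos (by linarith)
  have hA' : 0 ≤ max (max (max A₁ A₂) A₃) 0 := le_max_right _ _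
  have hC' : 0 ≤ max (max C₂ C₃) 0 := le_max_right _ _
  have hr : 0 ≤ ‖(z : ℂ) - 1‖ := norm_nonneg _
  have hP : 0 ≤ (x : ℝ) * (Real.log (x : ℝ)) ^ ((k : ℝ) * ((z : ℂ).re - 1)) :=
    mul_nonneg (by positivity) (Real.rpow_nonneg hlogx.le _)
  set N : ℕ → ℕ := fun n => ∑ i, (((f i).eval (n : ℤ)).toNat.factorization.sum fun _ v => min v 2)
    with hNdef
  by_cases hax : z.im = 0 ∧ 0 < z.re
  · -- the positive real axis: `z = t`
    obtain ⟨him, htpos⟩ := hax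
    set t : ℝ := z.re with htdef
    have hzt : z = ((t : ℝ) : ℂ) := eq_ofReal_of_im_eq_zero him
    have hsum : ‖∑ n ∈ Finset.range (x + 1), (z : ℂ) ^ N n‖ = ∑ n ∈ Finset.range (x + 1), t ^ N n := by
      rw [hzt]; exact norm_sum_ofReal_pow t htpos.le _ _
    have hnorm : ‖(z : ℂ) - 1‖ = |t - 1| := by
      rw [hzt, show ((t : ℝ) : ℂ) - 1 = ((t - 1 : ℝ) : ℂ) by push_cast; ring, Complex.norm_real,
        Real.norm_eq_abs]
    rw [hsum]
    by_cases htT : t ≤ T₀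
    · -- fixed interval
      have h1 := hfix x hx₁ t htpos htT
      calc ∑ n ∈ Finset.range (x + 1), t ^ N n
          ≤ A₁ * (x : ℝ) * (Real.log (x : ℝ)) ^ ((k : ℝ) * (t - 1)) := h1
        _ = A₁ * ((x : ℝ) * (Real.log (x : ℝ)) ^ ((k : ℝ) * ((z : ℂ).re - 1))) *
              Real.exp (0 * ‖(z : ℂ) - 1‖ * Real.log (‖(z : ℂ) - 1‖ + 2)) := by
            rw [htdef]; simp [mul_assoc]
        _ ≤ max (max (max A₁ A₂) A₃) 0 * ((x : ℝ) * (Real.log (x : ℝ)) ^ ((k : ℝ) * ((z : ℂ).re - 1))) *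
              Real.exp (max (max C₂ C₃) 0 * ‖(z : ℂ) - 1‖ * Real.log (‖(z : ℂ) - 1‖ + 2)) :=
            majorant_mono (le_trans (le_trans (le_max_left _ _) (le_max_left _ _)) (le_max_left _ _))
              hA' hC' hP hr
        _ = _ := by ring
    · -- growing `t`
      have hT₀t : T₀ ≤ t := le_of_lt (lt_of_not_ge htT)
      have ht1 : 0 ≤ t - 1 := by linarith
      have habs : |t - 1| = t - 1 := abs_of_nonneg ht1
      have hz' : t - 1 ≤ 3 * Real.log (Real.log (x : ℝ)) := by rw [← habs, ← hnorm]; exact hz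
      have h2 := hgrow x hx₂ t hT₀t hz'
      calc ∑ n ∈ Finset.range (x + 1), t ^ N n
          ≤ A₂ * (x : ℝ) * (Real.log (x : ℝ)) ^ ((k : ℝ) * (t - 1)) *
              Real.exp (C₂ * (t - 1) * Real.log ((t - 1) + 2)) := h2
        _ = A₂ * ((x : ℝ) * (Real.log (x : ℝ)) ^ ((k : ℝ) * ((z : ℂ).re - 1))) *
              Real.exp (C₂ * ‖(z : ℂ) - 1‖ * Real.log (‖(z : ℂ) - 1‖ + 2)) := by
            rw [hnorm, habs, htdef]; ring
        _ ≤ max (max (max A₁ A₂) A₃) 0 * ((x : ℝ) * (Real.log (x : ℝ)) ^ ((k : ℝ) * ((z : ℂ).re - 1))) *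
              Real.exp (max (max C₂ C₃) 0 * ‖(z : ℂ) - 1‖ * Real.log (‖(z : ℂ) - 1‖ + 2)) :=
            majorant_mono (le_trans (le_trans (le_max_right _ _) (le_max_left _ _)) (le_max_left _ _))
              hA' ((le_max_left _ _).trans (le_max_left _ _)) hP hr
        _ = _ := by ring
  · -- off the positive axis
    have h3 := hoff x hx₃ z hz hre hax
    calc ‖∑ n ∈ Finset.range (x + 1), (z : ℂ) ^ N n‖
        ≤ A₃ * (x : ℝ) * (Real.log (x : ℝ)) ^ ((k : ℝ) * ((z : ℂ).re - 1)) *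
            Real.exp (C₃ * ‖(z : ℂ) - 1‖ * Real.log (‖(z : ℂ) - 1‖ + 2)) := h3
      _ = A₃ * ((x : ℝ) * (Real.log (x : ℝ)) ^ ((k : ℝ) * ((z : ℂ).re - 1))) *
            Real.exp (C₃ * ‖(z : ℂ) - 1‖ * Real.log (‖(z : ℂ) - 1‖ + 2)) := by ring
      _ ≤ max (max (max A₁ A₂) A₃) 0 * ((x : ℝ) * (Real.log (x : ℝ)) ^ ((k : ℝ) * ((z : ℂ).re - 1))) *
            Real.exp (max (max C₂ C₃) 0 * ‖(z : ℂ) - 1‖ * Real.log (‖(z : ℂ) - 1‖ + 2)) :=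
          majorant_mono ((le_max_right _ _).trans (le_max_left _ _)) hA'
            ((le_max_right _ _).trans (le_max_left _ _)) hP hr
      _ = _ := by ring

/-- **Composition: the four stubs imply the crux `DiscMajorantLog` (the `Re z = 0` cut).**
Pointwise in `z`: right half-disc from `rightHalf_of_stubs`, left half-disc from
`stub_leftHalfDiscMajorantLog`; constants `max`-ed, `x₀ ≥ 2` so that `log x > 0`. -/
theorem DiscMajorantLog_of : DiscMajorantLog := by
  intro k f hf
  obtain ⟨A₁, C₁, x₁, h₁⟩ := rightHalf_of_stubs k f hf
  obtain ⟨A₂, C₂, x₂, h₂⟩ := stub_leftHalfDiscMajorantLog k f hf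
  refine ⟨max (max A₁ A₂) 0, max C₁ C₂, max (max x₁ x₂) 2, fun x hx z hz => ?_⟩
  have hx₁ : x₁ ≤ x := (le_max_left _ _).trans ((le_max_left _ _).trans hx)
  have hx₂ : x₂ ≤ x := (le_max_right _ _).trans ((le_max_left _ _).trans hx)
  have hx2 : (2 : ℝ) ≤ x := by exact_mod_cast (le_max_right _ _).trans hx
  have hlogx : 0 < Real.log (x : ℝ) := Real.log_pos (by linarith)
  have hP : 0 ≤ (x : ℝ) * (Real.log (x : ℝ)) ^ ((k : ℝ) * ((z : ℂ).re - 1)) :=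
    mul_nonneg (by positivity) (Real.rpow_nonneg hlogx.le _)
  have hr : 0 ≤ ‖(z : ℂ) - 1‖ := norm_nonneg _
  have hA' : 0 ≤ max (max A₁ A₂) 0 := le_max_right _ _
  by_cases hre : 0 ≤ z.re
  · calc ‖(∑ n ∈ Finset.range (x + 1), (z : ℂ) ^ (∑ i, (((f i).eval (n : ℤ)).toNat.factorization.sum fun _ v => min v 2)))‖
        ≤ A₁ * (x : ℝ) * (Real.log (x : ℝ)) ^ ((k : ℝ) * ((z : ℂ).re - 1)) *
            Real.exp (C₁ * ‖(z : ℂ) - 1‖ * Real.log (‖(z : ℂ) - 1‖ + 2)) := h₁ x hx₁ z hz hre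
      _ = A₁ * ((x : ℝ) * (Real.log (x : ℝ)) ^ ((k : ℝ) * ((z : ℂ).re - 1))) *
            Real.exp (C₁ * ‖(z : ℂ) - 1‖ * Real.log (‖(z : ℂ) - 1‖ + 2)) := by ring
      _ ≤ max (max A₁ A₂) 0 * ((x : ℝ) * (Real.log (x : ℝ)) ^ ((k : ℝ) * ((z : ℂ).re - 1))) *
            Real.exp (max C₁ C₂ * ‖(z : ℂ) - 1‖ * Real.log (‖(z : ℂ) - 1‖ + 2)) :=
          majorant_mono ((le_max_left _ _).trans (le_max_left _ _)) hA' (le_max_left _ _) hP hr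
      _ = _ := by ring
  · have hre' : z.re < 0 := lt_of_not_ge hre
    calc ‖(∑ n ∈ Finset.range (x + 1), (z : ℂ) ^ (∑ i, (((f i).eval (n : ℤ)).toNat.factorization.sum fun _ v => min v 2)))‖
        ≤ A₂ * (x : ℝ) * (Real.log (x : ℝ)) ^ ((k : ℝ) * ((z : ℂ).re - 1)) *
            Real.exp (C₂ * ‖(z : ℂ) - 1‖ * Real.log (‖(z : ℂ) - 1‖ + 2)) := h₂ x hx₂ z hz hre'
      _ = A₂ * ((x : ℝ) * (Real.log (x : ℝ)) ^ ((k : ℝ) * ((z : ℂ).re - 1))) *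
            Real.exp (C₂ * ‖(z : ℂ) - 1‖ * Real.log (‖(z : ℂ) - 1‖ + 2)) := by ring
      _ ≤ max (max A₁ A₂) 0 * ((x : ℝ) * (Real.log (x : ℝ)) ^ ((k : ℝ) * ((z : ℂ).re - 1))) *
            Real.exp (max C₁ C₂ * ‖(z : ℂ) - 1‖ * Real.log (‖(z : ℂ) - 1‖ + 2)) :=
          majorant_mono ((le_max_right _ _).trans (le_max_left _ _)) hA' (le_max_right _ _) hP hr
      _ = _ := by ring

/-! ## Landed stubs of this line (kernel-checked, imported above; re-exported by name so the audit sees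
them connected to the line) -/

/-- **Landed part of line `Sketch`** (bundle, by name): the large-prime switch for `X² + 1` (p140630),
the `k = 0` row (p140771), the left-half twin violation (p140801), the right-half twin blindness
(p140846). -/
theorem landedStubs :
    (∀ x : ℕ, 1 ≤ x → ∀ z : ℂ,
      (∑ n ∈ Finset.range (x + 1), z ^ ((n ^ 2 + 1).factorization.sum fun _ v => min v 2)) =
        (∑ n ∈ (Finset.range (x + 1)).filter (fun n => ∀ p ∈ (n ^ 2 + 1).primeFactors, p ≤ x),
            z ^ ((n ^ 2 + 1).factorization.sum fun _ v => min v 2)) +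
          z * ∑ m ∈ Finset.Icc 1 x, z ^ (m.factorization.sum fun _ v => min v 2) *
            (((Finset.range (x + 1)).filter fun n =>
                m ∣ n ^ 2 + 1 ∧ ((n ^ 2 + 1) / m).Prime ∧ x < (n ^ 2 + 1) / m).card : ℂ)) ∧
    (∀ (f : Fin 0 → Polynomial ℤ), Literature.NumberTheory.Sieve.IsBatemanHornSystem f →
      ∃ A C : ℝ, ∃ x₀ : ℕ, ∀ x : ℕ, x₀ ≤ x → ∀ z : ℂ, ‖z - 1‖ ≤ 3 * Real.log (Real.log (x : ℝ)) →
        ‖(∑ n ∈ Finset.range (x + 1), (z : ℂ) ^ (∑ i, (((f i).eval (n : ℤ)).toNat.factorization.sum fun _ v => min v 2)))‖ ≤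
          A * (x : ℝ) * (Real.log (x : ℝ)) ^ (((0 : ℕ) : ℝ) * ((z : ℂ).re - 1)) *
            Real.exp (C * ‖(z : ℂ) - 1‖ * Real.log (‖(z : ℂ) - 1‖ + 2))) ∧
    (¬ ∀ (k : ℕ) (f : Fin k → Polynomial ℤ), Literature.NumberTheory.Sieve.IsBatemanHornSystem f →
      ∃ A C : ℝ, ∃ x₀ : ℕ, ∀ x : ℕ, x₀ ≤ x → ∀ z : ℂ, ‖z - 1‖ ≤ 3 * Real.log (Real.log (x : ℝ)) →
        z.re < 0 →
        ‖(∑ n ∈ Finset.range (x + 1), (z : ℂ) ^ (∑ i, (((f i).eval (n : ℤ)).toNat.factorization.sum fun _ v => min v 2))) +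
            (∑ n ∈ Finset.range (x + 1), (-z : ℂ) ^ (∑ i, (((f i).eval (n : ℤ)).toNat.factorization.sum fun _ v => min v 2)))‖ ≤
          A * (x : ℝ) * (Real.log (x : ℝ)) ^ ((k : ℝ) * ((z : ℂ).re - 1)) *
            Real.exp (C * ‖(z : ℂ) - 1‖ * Real.log (‖(z : ℂ) - 1‖ + 2))) ∧
    (DiscMajorantLog →
      ∀ (k : ℕ) (f : Fin k → Polynomial ℤ), Literature.NumberTheory.Sieve.IsBatemanHornSystem f →
      ∃ A C : ℝ, ∃ x₀ : ℕ, ∀ x : ℕ, x₀ ≤ x → ∀ z : ℂ, ‖z - 1‖ + 2 ≤ 3 * Real.log (Real.log (x : ℝ)) →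
        0 ≤ z.re →
        ‖(∑ n ∈ Finset.range (x + 1), (z : ℂ) ^ (∑ i, (((f i).eval (n : ℤ)).toNat.factorization.sum fun _ v => min v 2))) +
            (∑ n ∈ Finset.range (x + 1), (-z : ℂ) ^ (∑ i, (((f i).eval (n : ℤ)).toNat.factorization.sum fun _ v => min v 2)))‖ ≤
          A * (x : ℝ) * (Real.log (x : ℝ)) ^ ((k : ℝ) * ((z : ℂ).re - 1)) *
            Real.exp (C * ‖(z : ℂ) - 1‖ * Real.log (‖(z : ℂ) - 1‖ + 2))) :=
  ⟨stub_largePrimeSwitch, stub_finZero, stub_leftHalfTwinViolation, stub_rightHalfTwinOfDisc⟩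

/-- **Landed calibration, every monic linear system on FIXED discs** (re-export of `stub_fixedDiscXAdd`,
p144164; `c = 0` is `stub_fixedDiscX`, p141351). -/
theorem fixedDiscXAdd (c : ℤ) (R₀ : ℝ) :
    ∃ A C : ℝ, ∃ x₀ : ℕ, ∀ x : ℕ, x₀ ≤ x → ∀ z : ℂ, ‖z - 1‖ ≤ R₀ →
      ‖(∑ n ∈ Finset.range (x + 1), (z : ℂ) ^ (∑ i, ((((![Polynomial.X + Polynomial.C c] : Fin 1 → Polynomial ℤ) i).eval
          (n : ℤ)).toNat.factorization.sum fun _ v => min v 2)))‖ ≤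
        A * (x : ℝ) * (Real.log (x : ℝ)) ^ (((1 : ℕ) : ℝ) * ((z : ℂ).re - 1)) *
          Real.exp (C * ‖(z : ℂ) - 1‖ * Real.log (‖(z : ℂ) - 1‖ + 2)) :=
  stub_fixedDiscXAdd c R₀

/-- **Landed calibration, the `k = 1`, `f = X` cell on the GROWING disc at the crux's own constants**
(re-export of `stub_growingDiscX`, p144724 = E4(E1, E2b∘E2a, E3, Rankin) by name): both composition
halves hold for this system. -/
theorem growingDiscX :
    ∃ A C : ℝ, ∃ x₀ : ℕ, ∀ x : ℕ, x₀ ≤ x → ∀ z : ℂ, ‖z - 1‖ ≤ 3 * Real.log (Real.log (x : ℝ)) →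
      ‖(∑ n ∈ Finset.range (x + 1), (z : ℂ) ^ (∑ i, ((((![Polynomial.X] : Fin 1 → Polynomial ℤ) i).eval
          (n : ℤ)).toNat.factorization.sum fun _ v => min v 2)))‖ ≤
        A * (x : ℝ) * (Real.log (x : ℝ)) ^ (((1 : ℕ) : ℝ) * ((z : ℂ).re - 1)) *
          Real.exp (C * ‖(z : ℂ) - 1‖ * Real.log (‖(z : ℂ) - 1‖ + 2)) :=
  stub_growingDiscX

/-! ### Landed in wave 1 of lead c1 (by name) -/

/-- **Composition stub R-fixed, landed** (re-export of `stub_realAxisFixedInterval`, p150589): the positive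
real segment `0 < t ≤ T` of the crux for EVERY Bateman–Horn system and every fixed `T ≥ 1`. -/
theorem realAxisFixedInterval :
    ∀ (k : ℕ) (f : Fin k → Polynomial ℤ), Literature.NumberTheory.Sieve.IsBatemanHornSystem f →
      ∀ T : ℝ, 1 ≤ T → ∃ A : ℝ, ∃ x₀ : ℕ, ∀ x : ℕ, x₀ ≤ x → ∀ t : ℝ, 0 < t → t ≤ T →
        (∑ n ∈ Finset.range (x + 1), t ^ (∑ i, (((f i).eval (n : ℤ)).toNat.factorization.sum fun _ v => min v 2))) ≤
          A * (x : ℝ) * (Real.log (x : ℝ)) ^ ((k : ℝ) * (t - 1)) :=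
  stub_realAxisFixedInterval

/-- **The complete classical class, landed** (re-export of `discMajorantLog_of_linear`, p150865, by name
from p147027 p147196 p147112 p149882 p147327 p147350): `DiscMajorantLog` for every system with `k = 1`,
`deg = 1` (with the `k = 0` row of `landedStubs`: every Bateman–Horn system with `k ≤ 1`, `deg ≤ 1`). -/
theorem linearClass :
    ∀ (k : ℕ) (f : Fin k → Polynomial ℤ), Literature.NumberTheory.Sieve.IsBatemanHornSystem f →
      k = 1 → (∀ i, (f i).natDegree = 1) →
      ∃ A C : ℝ, ∃ x₀ : ℕ, ∀ x : ℕ, x₀ ≤ x → ∀ z : ℂ, ‖z - 1‖ ≤ 3 * Real.log (Real.log (x : ℝ)) →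
        ‖(∑ n ∈ Finset.range (x + 1), (z : ℂ) ^ (∑ i, (((f i).eval (n : ℤ)).toNat.factorization.sum fun _ v => min v 2)))‖ ≤
          A * (x : ℝ) * (Real.log (x : ℝ)) ^ ((k : ℝ) * ((z : ℂ).re - 1)) *
            Real.exp (C * ‖(z : ℂ) - 1‖ * Real.log (‖(z : ℂ) - 1‖ + 2)) :=
  discMajorantLog_of_linear

/-- **The parity-free core, landed** (re-export of `discMajorantLog_shrinkingDisc`, p151291): for every
Bateman–Horn system the crux holds VERBATIM with budget constant `C = 0` on the shrinking disc
`‖z − 1‖ ≤ 1/2`, `‖z − 1‖² log log x ≤ 1`. -/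
theorem shrinkingDisc :
    ∀ (k : ℕ) (f : Fin k → Polynomial ℤ), Literature.NumberTheory.Sieve.IsBatemanHornSystem f →
      ∃ A : ℝ, ∃ x₀ : ℕ, ∀ x : ℕ, x₀ ≤ x → ∀ z : ℂ, ‖z - 1‖ ≤ 1 / 2 →
        ‖z - 1‖ ^ 2 * Real.log (Real.log (x : ℝ)) ≤ 1 →
        ‖(∑ n ∈ Finset.range (x + 1), (z : ℂ) ^ (∑ i, (((f i).eval (n : ℤ)).toNat.factorization.sum fun _ v => min v 2)))‖ ≤
          A * (x : ℝ) * (Real.log (x : ℝ)) ^ ((k : ℝ) * ((z : ℂ).re - 1)) :=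
  discMajorantLog_shrinkingDisc

end Summit.Parity.BatemanHorn.Cruxes.DiscMajorantLog.Sketch

end
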